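import Summits.Ventures.PercRepro.Night2PartialCells

/-!
# PercRepro — THE `(7, 5)` CELLS `(3, 0)` AND `(3, 1)` IN THEIR PARTIAL-SPREAD REGIMES, FOR EVERY FLAT (night-2, gen 19)

`Night2ThreeCells` closed `(3, 0)` for `|G| ≥ 16` and `(3, 1)` for `|G| ≥ 21` with no hypothesis on the members; the
partial-spread theorem removes the size bound: if every NON-BASIS thin member (`|B ∖ K| ≥ ρ`) misses at least `4`
points of `G`, the crude target sum holds for every `n`:
* `(3, 0)` with `m₁ = 4` (`ρ = 6`, `t = 3`, `c′ = 1/3`, `λ = 1/15`): `6 C(n, 6) ≤ 5 A + 15 T` for every `n ≥ 9`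
  (minimum ratio `1.143` at `n = 10`);
* `(3, 1)` with `m₁ = 4` (`ρ = 5`, `t = 3`, `c′ = 5/24`, `λ = 11/120`): `11 C(n, 5) ≤ 5 A + 24 T` for every `n ≥ 8`
  (minimum `1.080` at `n = 10`).
**`localShadowHall_three_zero_five_of_partial`**, **`localShadowHall_three_one_five_of_partial`**.
-/

namespace PercRepro.Shadow

open Finset PerFlat ThmH

namespace DGenP

/-! ## The cell `(3, 0)` with `m₁ = 4` -/

/-- `c′ = 1/3` at `(q, d, ρ, k, m₁) = (5, 3, 6, 0, 4)`. -/
theorem cPrimeDGP_three_zero : cPrimeDGP 5 3 6 0 4 = 1 / 3 := by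
  unfold cPrimeDGP capDG reqDGP phiQ; norm_num

/-- `5 (C(n, 7) + C(n, 8)) ≥ 6 C(n, 6)` for `n ≥ 12`. -/
theorem three_zero_growth {n : ℕ} (hn : 12 ≤ n) : 6 * n.choose 6 ≤ 5 * (n.choose 7 + n.choose 8) := by
  obtain ⟨m, rfl⟩ : ∃ m, n = m + 12 := ⟨n - 12, by omega⟩
  have h7 := Nat.choose_succ_right_eq (m + 12) 6
  have h8 := Nat.choose_succ_right_eq (m + 12) 7
  rw [show m + 12 - 6 = m + 6 by omega] at h7
  rw [show m + 12 - 7 = m + 5 by omega] at h8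
  have l7 : 6 * (m + 12).choose 6 ≤ 7 * (m + 12).choose 7 := by
    nlinarith [h7, Nat.zero_le ((m + 12).choose 6 * m)]
  have l8 : 5 * (m + 12).choose 7 ≤ 8 * (m + 12).choose 8 := by
    nlinarith [h8, Nat.zero_le ((m + 12).choose 7 * m)]
  omega

/-- The bounded range `9 ≤ n ≤ 11` of the `(3, 0)` partial inequality. -/
theorem three_zero_pineq_small {n : ℕ} (hn : 9 ≤ n) (hn' : n ≤ 11) :
    6 * n.choose 6 ≤ 5 * DGen.Aρt n 6 3 + 15 * DGen.Ttop n 3 := by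
  have hid : (∑ i ∈ Finset.range 7, n.choose i) + DGen.Aρt n 6 3 + DGen.Ttop n 3 = 2 ^ n :=
    DGen.sum_range_add_Aρt_add_Ttop (by omega)
  have key : 6 * n.choose 6 + 5 * (∑ i ∈ Finset.range 7, n.choose i) ≤ 5 * 2 ^ n + 10 * DGen.Ttop n 3 := by
    unfold DGen.Ttop
    interval_cases n <;> decide
  omega

/-- **The `(3, 0)` partial inequality** `6 C(n, 6) ≤ 5 A + 15 T` for every `n ≥ 9`. -/
theorem three_zero_pineq {n : ℕ} (hn : 9 ≤ n) : 6 * n.choose 6 ≤ 5 * DGen.Aρt n 6 3 + 15 * DGen.Ttop n 3 := by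
  by_cases h : n ≤ 11
  · exact three_zero_pineq_small hn h
  · push Not at h
    have hA : n.choose 7 + n.choose 8 ≤ DGen.Aρt n 6 3 := DGen.Aρt_ge_two (by omega)
    have h2 := three_zero_growth (by omega : 12 ≤ n)
    omega

/-- The target sum of the cell `(3, 0)` (`m₁ = 4`) is at least `1` for every `n ≥ 9`. -/
theorem one_le_genSum_three_zero {n : ℕ} (hn : 9 ≤ n) :
    1 ≤ genSum n 6 3 (cPrimeDGP 5 3 6 0 4) (lambdaDG 5 3 6 0) := by
  rw [cPrimeDGP_three_zero, DGen.lambdaDG_five_three_six_zero, genSum_eq (by omega) (by norm_num) (by norm_num)]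
  have hC : (0 : ℚ) < (n.choose 6 : ℚ) := by exact_mod_cast Nat.choose_pos (by omega)
  rw [le_div_iff₀ (by positivity)]
  have key' : (6 : ℚ) * (n.choose 6 : ℚ) ≤ 5 * (DGen.Aρt n 6 3 : ℚ) + 15 * (DGen.Ttop n 3 : ℚ) := by
    exact_mod_cast three_zero_pineq hn
  norm_num
  linarith

/-! ## The cell `(3, 1)` with `m₁ = 4` -/

/-- `c′ = 5/24` at `(q, d, ρ, k, m₁) = (5, 3, 5, 1, 4)`. -/
theorem cPrimeDGP_three_one : cPrimeDGP 5 3 5 1 4 = 5 / 24 := by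
  unfold cPrimeDGP capDG reqDGP phiQ; norm_num

/-- `5 (C(n, 6) + C(n, 7)) ≥ 11 C(n, 5)` for `n ≥ 13`. -/
theorem three_one_growth {n : ℕ} (hn : 13 ≤ n) : 11 * n.choose 5 ≤ 5 * (n.choose 6 + n.choose 7) := by
  obtain ⟨m, rfl⟩ : ∃ m, n = m + 13 := ⟨n - 13, by omega⟩
  have h6 := Nat.choose_succ_right_eq (m + 13) 5
  have h7 := Nat.choose_succ_right_eq (m + 13) 6
  rw [show m + 13 - 5 = m + 8 by omega] at h6
  rw [show m + 13 - 6 = m + 7 by omega] at h7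
  have l6 : 8 * (m + 13).choose 5 ≤ 6 * (m + 13).choose 6 := by
    nlinarith [h6, Nat.zero_le ((m + 13).choose 5 * m)]
  have l7 : 7 * (m + 13).choose 6 ≤ 7 * (m + 13).choose 7 := by
    nlinarith [h7, Nat.zero_le ((m + 13).choose 6 * m)]
  omega

/-- The bounded range `8 ≤ n ≤ 12` of the `(3, 1)` partial inequality. -/
theorem three_one_pineq_small {n : ℕ} (hn : 8 ≤ n) (hn' : n ≤ 12) :
    11 * n.choose 5 ≤ 5 * DGen.Aρt n 5 3 + 24 * DGen.Ttop n 3 := by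
  have hid : (∑ i ∈ Finset.range 6, n.choose i) + DGen.Aρt n 5 3 + DGen.Ttop n 3 = 2 ^ n :=
    DGen.sum_range_add_Aρt_add_Ttop (by omega)
  have key : 11 * n.choose 5 + 5 * (∑ i ∈ Finset.range 6, n.choose i) ≤ 5 * 2 ^ n + 19 * DGen.Ttop n 3 := by
    unfold DGen.Ttop
    interval_cases n <;> decide
  omega

/-- **The `(3, 1)` partial inequality** `11 C(n, 5) ≤ 5 A + 24 T` for every `n ≥ 8`. -/
theorem three_one_pineq {n : ℕ} (hn : 8 ≤ n) : 11 * n.choose 5 ≤ 5 * DGen.Aρt n 5 3 + 24 * DGen.Ttop n 3 := by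
  by_cases h : n ≤ 12
  · exact three_one_pineq_small hn h
  · push Not at h
    have hA : n.choose 6 + n.choose 7 ≤ DGen.Aρt n 5 3 := DGen.Aρt_ge_two (by omega)
    have h2 := three_one_growth (by omega : 13 ≤ n)
    omega

/-- The target sum of the cell `(3, 1)` (`m₁ = 4`) is at least `1` for every `n ≥ 8`. -/
theorem one_le_genSum_three_one {n : ℕ} (hn : 8 ≤ n) :
    1 ≤ genSum n 5 3 (cPrimeDGP 5 3 5 1 4) (lambdaDG 5 3 5 1) := by
  rw [cPrimeDGP_three_one, DGen.lambdaDG_five_three_five_one, genSum_eq (by omega) (by norm_num) (by norm_num)]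
  have hC : (0 : ℚ) < (n.choose 5 : ℚ) := by exact_mod_cast Nat.choose_pos (by omega)
  rw [le_div_iff₀ (by positivity)]
  have key' : (11 : ℚ) * (n.choose 5 : ℚ) ≤ 5 * (DGen.Aρt n 5 3 : ℚ) + 24 * (DGen.Ttop n 3 : ℚ) := by
    exact_mod_cast three_one_pineq hn
  norm_num
  linarith

end DGenP

variable {α : Type*} [DecidableEq α] {M : Matroid α} [M.Finite]

open scoped Classical in
/-- **THE `(7, 5)` CELL `(3, 0)` IN THE `4`-PARTIAL-SPREAD REGIME, FOR EVERY FLAT**: every thin member with `|B| ≥ 6`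
misses at least `4` points of `G`. -/
theorem localShadowHall_three_zero_five_of_partial {G : Finset α} (hG : G ∈ flatsQ M (5 + 1))
    (hd : (gr M \ G).card = 3) (hk : kColoops M G = 0)
    (hs : ∀ e ∈ gr M, ∀ f ∈ gr M, e ≠ f → rkN M {e, f} = 2) (hl : ∀ e ∈ gr M, M.Indep {e})
    (hm₁ : ∀ B ∈ thinMembers M 5 G, 6 ≤ (B \ coloops M G).card → 4 ≤ (G \ clF M B).card) :
    LocalShadowHall M 5 G := by
  by_cases hn : 9 ≤ G.card - kColoops M G
  · exact localShadowHall_dgenP_of_sum (d := 3) (ρ := 6) (m₁ := 4) hG hd (by norm_num) (by rw [hk])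
      (by norm_num) (by omega) hs hl (by rw [hk, DGenP.cPrimeDGP_three_zero]; norm_num)
      (by rw [hk, DGen.lambdaDG_five_three_six_zero]; norm_num) hm₁
      (by rw [hk] at hn ⊢; exact DGenP.one_le_genSum_three_zero hn)
  · exact localShadowHall_of_spread (ρ := 6) (m₀ := 4) hG hd (by norm_num) (by rw [hk])
      (fun B hB => absurd (thin_card_bound (ρ := 6) hG hd (by norm_num) (by rw [hk]) hB) (by omega))
      (by rw [hk]; unfold phiQ; norm_num)

open scoped Classical in
/-- **THE `(7, 5)` CELL `(3, 1)` IN THE `4`-PARTIAL-SPREAD REGIME, FOR EVERY FLAT**: every thin member with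
`|B ∖ K| ≥ 5` misses at least `4` points of `G`. -/
theorem localShadowHall_three_one_five_of_partial {G : Finset α} (hG : G ∈ flatsQ M (5 + 1))
    (hd : (gr M \ G).card = 3) (hk : kColoops M G = 1)
    (hs : ∀ e ∈ gr M, ∀ f ∈ gr M, e ≠ f → rkN M {e, f} = 2) (hl : ∀ e ∈ gr M, M.Indep {e})
    (hm₁ : ∀ B ∈ thinMembers M 5 G, 5 ≤ (B \ coloops M G).card → 4 ≤ (G \ clF M B).card) :
    LocalShadowHall M 5 G := by
  by_cases hn : 8 ≤ G.card - kColoops M G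
  · exact localShadowHall_dgenP_of_sum (d := 3) (ρ := 5) (m₁ := 4) hG hd (by norm_num) (by rw [hk])
      (by norm_num) (by omega) hs hl (by rw [hk, DGenP.cPrimeDGP_three_one]; norm_num)
      (by rw [hk, DGen.lambdaDG_five_three_five_one]; norm_num) hm₁
      (by rw [hk] at hn ⊢; exact DGenP.one_le_genSum_three_one hn)
  · exact localShadowHall_of_spread (ρ := 5) (m₀ := 6) hG hd (by norm_num) (by rw [hk])
      (fun B hB => absurd (thin_card_bound (ρ := 5) hG hd (by norm_num) (by rw [hk]) hB) (by omega))
      (by rw [hk]; unfold phiQ; norm_num)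

end PercRepro.Shadow
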